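import Mathlib

/-!
# Tier4/Common/ProdSliceBound — the SLICE BOUND for a product measure cut by `D ×ˢ univ`:
`m · ν₁ (D ∩ U) ≤ (ν₁ ⊗ ν₂) (S ∩ D ×ˢ univ)` when every slice `S_c`, `c ∈ U`, has `ν₂`-measure `≥ m`

Blind re-derivation cell `pub-hodge-repro`, Tier 4 (README §9–§10), seat t4-typer-1 (gen 3).  Target tree path
`lean/Summits/Ventures/HodgeRepro/Tier4/Common/ProdSliceBound.lean`.  Imports Mathlib only; companion of `SaturationMeasure`
(p710190) for the (β) unit of the folded ratio (F) — the CORRECTED instance recipe of STATUS S15738.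

WHY: the unfolded unit of the Line-4 chain is `suppMeasure N γ₀ = (νf ⊗ νf′)(suppSet γ₀ N γ₀ ∩ DZf ×ˢ univ)` with `DZf` a
fundamental domain of `Z(k)` in the FIRST factor `T_f` and `suppSet` invariant under the DIAGONAL centre only — so the
saturation bound of `SaturationMeasure` applies on the first factor alone (`νf (DZf ∩ Z_f·L_N) ≥ νf (Z⁰_f·L_N) / #(Z(k) ∩ Z⁰_f·L_N)`)
and the product is handled by Fubini: for `c ∈ Z_f·L_N` the slice `{c′ : (c, c′) ∈ suppSet γ₀}` contains a translate of
`L′_N`, hence `(νf ⊗ νf′)(suppSet γ₀ ∩ DZf ×ˢ univ) ≥ νf′(L′_N) · νf(DZf ∩ Z_f·L_N)`.  `prod_measure_inter_prod_univ_ge` is that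
Fubini step for ANY s-finite `ν₂`, measurable `S`, `D`, `U` and slice lower bound `m`; `prod_measure_inter_prod_univ_eq_lintegral`
is the underlying identity `(ν₁ ⊗ ν₂)(S ∩ D ×ˢ univ) = ∫⁻ c in D, ν₂ (Prod.mk c ⁻¹' S) ∂ν₁`.

Nothing here says anything about the status of the Hodge conjecture for CM abelian varieties, which is NOT proved
(HC_CM is NOT proved by anyone in this repository).
-/

set_option autoImplicit false

noncomputable section

open MeasureTheory Measure Set Function
open scoped NNReal ENNReal

namespace Summit.Ventures.HodgeRepro.Tier4.Common

section Slice

variable {A B : Type*} [MeasurableSpace A] [MeasurableSpace B] (ν₁ : Measure A) (ν₂ : Measure B) [SFinite ν₂]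

omit [MeasurableSpace A] [SFinite ν₂] in
/-- The `ν₂`-measure of the slice of `S ∩ D ×ˢ univ` at `c` is that of the slice of `S` when `c ∈ D` and `0` otherwise. -/
theorem measure_mk_preimage_inter_prod_univ (S : Set (A × B)) (D : Set A) (c : A) :
    ν₂ (Prod.mk c ⁻¹' (S ∩ D ×ˢ (univ : Set B))) = D.indicator (fun c => ν₂ (Prod.mk c ⁻¹' S)) c := by
  by_cases hc : c ∈ D
  · rw [preimage_inter, mk_preimage_prod_right hc, inter_univ, indicator_of_mem hc]
  · rw [preimage_inter, mk_preimage_prod_right_eq_empty hc, inter_empty, indicator_of_notMem hc, measure_empty]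

/-- **Fubini for the cut `S ∩ D ×ˢ univ`**: `(ν₁ ⊗ ν₂)(S ∩ D ×ˢ univ) = ∫⁻ c in D, ν₂ (Prod.mk c ⁻¹' S) ∂ν₁`. -/
theorem prod_measure_inter_prod_univ_eq_lintegral {S : Set (A × B)} (hS : MeasurableSet S) {D : Set A}
    (hD : MeasurableSet D) :
    (ν₁.prod ν₂) (S ∩ D ×ˢ (univ : Set B)) = ∫⁻ c in D, ν₂ (Prod.mk c ⁻¹' S) ∂ν₁ := by
  rw [Measure.prod_apply (hS.inter (hD.prod MeasurableSet.univ)), ← lintegral_indicator hD]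
  exact lintegral_congr fun c => measure_mk_preimage_inter_prod_univ ν₂ S D c

/-- **The slice bound**: if every slice `Prod.mk c ⁻¹' S`, `c ∈ U`, has `ν₂`-measure `≥ m`, then
`m * ν₁ (D ∩ U) ≤ (ν₁ ⊗ ν₂) (S ∩ D ×ˢ univ)`.
At `S := suppSet γ₀ N γ₀`, `D := DZf`, `U := Z_f·L_N`, `m := νf′ (L′_N)` this is the (β2) step of the unit lower bound. -/
theorem prod_measure_inter_prod_univ_ge {S : Set (A × B)} (hS : MeasurableSet S) {D U : Set A}
    (hD : MeasurableSet D) (hU : MeasurableSet U) {m : ℝ≥0∞} (hm : ∀ c ∈ U, m ≤ ν₂ (Prod.mk c ⁻¹' S)) :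
    m * ν₁ (D ∩ U) ≤ (ν₁.prod ν₂) (S ∩ D ×ˢ (univ : Set B)) := by
  rw [prod_measure_inter_prod_univ_eq_lintegral ν₁ ν₂ hS hD, ← lintegral_indicator hD,
    ← lintegral_indicator_const (hD.inter hU) m]
  refine lintegral_mono fun c => ?_
  by_cases hc : c ∈ D ∩ U
  · rw [indicator_of_mem hc, indicator_of_mem hc.1]
    exact hm c hc.2
  · rw [indicator_of_notMem hc]
    exact zero_le

end Slice

end Summit.Ventures.HodgeRepro.Tier4.Common

end
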